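import Literature.Geometry.Lorentzian.KillingFlowIsometry
import Literature.Geometry.Lorentzian.IsometricImmersionExp
import Literature.Geometry.Lorentzian.GeodesicConfinement
import Summits.FinalStateConjecture.FinalStateConjecture.Theorems.ZeroEnergyKerrOrBombKerrZeroEnergyUntrappedKSEscape
import Summits.FinalStateConjecture.FinalStateConjecture.Theorems.ZeroEnergyKerrOrBombErgoregionBombModTNullFrequencyCompact

/-!
# Escape modulo the stationary flow (stub G3 of line `SketchIdeator4`, crux stmt-FinalStateConjecture-17838)

Route `ZeroEnergyKerrOrBomb`, crux `ErgoregionBombModT`, line `SketchIdeator4` (zero-energy escape).  The registered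
stub `stub_escapeModFlow`: a maximal null geodesic `γ` (domain `s`) of a stationary asymptotically flat black hole,
confined to the cage `⋃ₜ φₜ(S)` of a compact set `S`, whose Killing-time frequency `dτ(γ̇)` stays bounded on the
terminal segment `s ∩ [t₀, ∞)` (resp. initial segment `s ∩ (−∞, t₀]`) has a domain unbounded above (resp. below).
Here `τ` is a `C¹` Killing time on an open `W ⊇ ⋃ₜ φₜ(S)` (`τ(σ t) = τ(σ 0) + t` along the integral curves of `T`
issued from `W`) with spacelike level sets on `W` (`dτ(k) ≠ 0` for null `k ≠ 0`).

Proof (O'Neill 1983, Ch. 5, Lemma 8 — the escape lemma — modulo the isometry group; Chruściel–Costa 2008 §2.2 for the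
flow `φₜ` of the stationary Killing field): transport the tangent lift `(γ t, γ̇ t)` by the flow isometry `φ₋ᵣ`
(`γ t = φᵣ y`, `y ∈ S`) into the set of null vectors over `S` with `|dτ| ≤ B` (`dτ` is flow-invariant by the chain
rule, `g(γ̇, γ̇)` by the isometry), which lies in a compact subset of `TM` (`stub_nullFrequencyCompact`); there the
geodesics have a uniform existence time `ε` (`exists_uniform_isGeodesicOn_of_isCompact`); transporting the local
geodesic back by `φᵣ` (`IsIsometricImmersion.isGeodesicOn_comp`) gives a geodesic on `(−ε, ε)` with the tangent lift
of `γ` at `t`, so `t + ε/2 ∈ s` (`isMaximalGeodesicOn_add_mem_of_isGeodesicOn`) — impossible for `t` within `ε/2`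
of `sup s`.
-/

noncomputable section

open Bundle Set Filter Function
open scoped Manifold Topology ContDiff

set_option linter.dupNamespace false

namespace Summit.FinalStateConjecture.FinalStateConjecture.Theorems.ErgoregionBombModT

open Literature.Geometry.Lorentzian

/-- **Escape modulo the stationary flow** (registered stub G3 of line `SketchIdeator4`): see the module docstring.
O'Neill 1983, Ch. 5, Lemma 8, modulo the one-parameter group of isometries of Chruściel–Costa 2008, §2.2. -/
theorem stub_escapeModFlow : ∀ (𝓑 : StationaryAFBlackHole.{0}) [𝓑.metric.HasLeviCivita] (S W : Set 𝓑.carrier) (τ : 𝓑.carrier → ℝ) (B : ℝ), IsCompact S → IsOpen W → stationaryOrbit 𝓑.killing S ⊆ W → ContMDiffOn (𝓡 4) 𝓘(ℝ, ℝ) 1 τ W → (∀ σ : ℝ → 𝓑.carrier, IsMIntegralCurve σ 𝓑.killing → σ 0 ∈ W → ∀ t, τ (σ t) = τ (σ 0) + t) → (∀ x ∈ W, ∀ k : TangentSpace (𝓡 4) x, 𝓑.metric.val x k k = 0 → k ≠ 0 → mvfderiv (𝓡 4) τ x k ≠ 0) → ∀ (γ : ℝ → 𝓑.carrier) (s : Set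 ℝ), IsMaximalGeodesicOn 𝓑.metric.toPseudoRiemannianMetric.leviCivita γ s → (∀ t ∈ s, 𝓑.metric.val (γ t) (velocity (𝓡 4) γ t) (velocity (𝓡 4) γ t) = 0) → (∀ t ∈ s, γ t ∈ stationaryOrbit 𝓑.killing S) → ∀ t₀ ∈ s, ((∀ t ∈ s, t₀ ≤ t → |mvfderiv (𝓡 4) τ (γ t) (velocity (𝓡 4) γ t)| ≤ B) → ¬ BddAbove s) ∧ ((∀ t ∈ s, t ≤ t₀ → |mvfderiv (𝓡 4) τ (γ t) (velocity (𝓡 4) γ t)| ≤ B) → ¬ BddBelow s) := by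
  intro 𝓑 _ S W τ B hS hW hSW hτ heq hnd γ s hγ hnull hin t₀ ht₀
  -- instances: the Levi-Civita connection of the smooth metric is `C¹`
  haveI : Fact ((1 : ℕ∞ω) ≤ ((⊤ : ℕ∞) : WithTop ℕ∞)) := ⟨by exact_mod_cast le_top⟩
  haveI : CovariantDerivative.ContMDiffCovariantDerivative 𝓑.metric.leviCivita 1 :=
    ⟨𝓑.metric.toPseudoRiemannianMetric.isLocallyContMDiff_leviCivita_holds 1
      (by rw [show ((1 : ℕ∞) : ℕ∞ω) + 1 = 2 by norm_num]; exact WithTop.coe_le_coe.2 le_top)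
      univ isOpen_univ⟩
  -- the stationary flow
  obtain ⟨θ, hθ, hθ0, hθadd, hθX, hiso, -⟩ := 𝓑.exists_stationary_flow
  have hθ2 : ContMDiff (𝓘(ℝ, ℝ).prod (𝓡 4)) (𝓡 4) 2 θ := hθ.of_le (WithTop.coe_le_coe.mpr le_top)
  have hK : 𝓑.metric.IsKillingField 𝓑.killing := 𝓑.isStationaryKilling.isKillingField
  have hK1 : ContMDiff (𝓡 4) (𝓡 4).tangent 1
      (fun x ↦ (⟨x, 𝓑.killing x⟩ : TangentBundle (𝓡 4) 𝓑.carrier)) :=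
    hK.contMDiff.of_le (WithTop.coe_le_coe.mpr le_top)
  -- the flow maps are smooth isometric immersions
  have hφs : ∀ r : ℝ, ContMDiff (𝓡 4) (𝓡 4) ∞ (fun q ↦ θ (r, q)) := fun r ↦
    hθ.comp (contMDiff_const.prodMk contMDiff_id)
  have hφi : ∀ r : ℝ, PseudoRiemannianMetric.IsIsometricImmersion 𝓑.metric.toPseudoRiemannianMetric
      𝓑.metric.toPseudoRiemannianMetric (fun q ↦ θ (r, q)) := fun r ↦
    ⟨hφs r, fun y ↦ by
      ext v w
      rw [pullbackBilin_apply]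
      exact hiso r y v w⟩
  -- `S ⊆ W`
  have hSW' : S ⊆ W :=
    (subset_stationaryOrbit 𝓑.isStationaryKilling.isCompleteVectorField S).trans hSW
  -- the compact set of bounded-frequency null vectors over `S`, and its uniform existence time
  obtain ⟨𝒦, h𝒦, hmem⟩ := stub_nullFrequencyCompact 𝓑 S W τ B hS hW hSW' hτ hnd
  obtain ⟨ε, hε, huni⟩ :=
    exists_uniform_isGeodesicOn_of_isCompact (cov := 𝓑.metric.toPseudoRiemannianMetric.leviCivita) h𝒦
  -- KEY: at a parameter where the frequency is bounded, `s` contains an `ε`-interval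
  have key : ∀ t ∈ s, |mvfderiv (𝓡 4) τ (γ t) (velocity (𝓡 4) γ t)| ≤ B →
      ∀ u ∈ Ioo (-ε) ε, u + t ∈ s := by
    intro t ht hB u hu
    obtain ⟨σ, hσ, hσ0, r, hr⟩ := hin t ht
    -- `γ t = φᵣ (σ 0)`
    have hflow : γ t = θ (r, σ 0) := by rw [← hr]; exact eq_flow_of_isMIntegralCurve hK1 hθX hθ0 hσ r
    -- `φ₋ᵣ (γ t) = σ 0 ∈ S`
    have hback : θ (-r, γ t) = σ 0 := by rw [hflow]; exact flow_neg_apply_flow hθ0 hθadd r (σ 0)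
    -- the transported tangent vector
    set v : TangentSpace (𝓡 4) (γ t) := velocity (𝓡 4) γ t with hv
    set k : TangentSpace (𝓡 4) (θ (-r, γ t)) := mfderiv (𝓡 4) (𝓡 4) (fun q ↦ θ (-r, q)) (γ t) v
      with hk
    set p : TangentBundle (𝓡 4) 𝓑.carrier := ⟨θ (-r, γ t), k⟩ with hp
    -- it lies in `𝒦`: base point in `S`, null, frequency `≤ B`
    have hpS : p.proj ∈ S := by
      show θ (-r, γ t) ∈ S
      rw [hback]; exact hσ0
    have hpnull : 𝓑.metric.val p.proj p.2 p.2 = 0 := by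
      show 𝓑.metric.val (θ (-r, γ t)) k k = 0
      rw [hk, hiso (-r) (γ t) v v]
      exact hnull t ht
    have hγW : γ t ∈ W := hSW (hin t ht)
    have hτloc : (τ ∘ fun q ↦ θ (-r, q)) =ᶠ[𝓝 (γ t)] fun q ↦ τ q + (-r) := by
      filter_upwards [hW.mem_nhds hγW] with x hx
      have h := heq (fun s' ↦ θ (s', x)) (hθX x) (by simpa [hθ0] using hx) (-r)
      simpa [hθ0] using h
    have hτd : MDifferentiableAt (𝓡 4) 𝓘(ℝ, ℝ) τ (θ (-r, γ t)) :=
      ((hτ.contMDiffAt (hW.mem_nhds (by rw [hback]; exact hSW' hσ0))).mdifferentiableAt one_ne_zero)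
    have hτd' : MDifferentiableAt (𝓡 4) 𝓘(ℝ, ℝ) τ (γ t) :=
      ((hτ.contMDiffAt (hW.mem_nhds hγW)).mdifferentiableAt one_ne_zero)
    have hφd : MDifferentiableAt (𝓡 4) (𝓡 4) (fun q ↦ θ (-r, q)) (γ t) :=
      PseudoRiemannianMetric.mdifferentiableAt_flow hθ2 (-r) (γ t)
    have hchain : mfderiv (𝓡 4) 𝓘(ℝ, ℝ) (τ ∘ fun q ↦ θ (-r, q)) (γ t) =
        (mfderiv (𝓡 4) 𝓘(ℝ, ℝ) τ (θ (-r, γ t))).comp (mfderiv (𝓡 4) (𝓡 4) (fun q ↦ θ (-r, q)) (γ t)) :=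
      mfderiv_comp (γ t) hτd hφd
    have hshift : mfderiv (𝓡 4) 𝓘(ℝ, ℝ) (fun q ↦ τ q + (-r)) (γ t) = mfderiv (𝓡 4) 𝓘(ℝ, ℝ) τ (γ t) :=
      ((hτd'.hasMFDerivAt.add (hasMFDerivAt_const (I := 𝓡 4) (I' := 𝓘(ℝ, ℝ)) (-r) (γ t))).congr_mfderiv
        (add_zero _)).mfderiv
    have hfreq : mvfderiv (𝓡 4) τ (θ (-r, γ t)) k = mvfderiv (𝓡 4) τ (γ t) v := by
      show mfderiv (𝓡 4) 𝓘(ℝ, ℝ) τ (θ (-r, γ t)) k = mfderiv (𝓡 4) 𝓘(ℝ, ℝ) τ (γ t) v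
      rw [hk, ← ContinuousLinearMap.comp_apply, ← hchain, hτloc.mfderiv_eq, hshift]
      rfl
    have hpB : |mvfderiv (𝓡 4) τ p.proj p.2| ≤ B := by
      show |mvfderiv (𝓡 4) τ (θ (-r, γ t)) k| ≤ B
      rw [hfreq]; exact hB
    -- the local geodesic through `p` and its transport back by `φᵣ`
    obtain ⟨β, hβ, hβ0⟩ := huni p (hmem p hpS hpnull hpB)
    obtain ⟨hβ', hvel⟩ := (hφi r).isGeodesicOn_comp rfl isOpen_Ioo hβ
    have h00 : (0 : ℝ) ∈ Ioo (-ε) ε := ⟨neg_lt_zero.2 hε, hε⟩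
    have hlift : tangentLift (𝓡 4) ((fun q ↦ θ (r, q)) ∘ β) 0 = tangentLift (𝓡 4) γ t := by
      have h1 : tangentLift (𝓡 4) ((fun q ↦ θ (r, q)) ∘ β) 0 =
          tangentMap (𝓡 4) (𝓡 4) (fun q ↦ θ (r, q)) (tangentLift (𝓡 4) β 0) :=
        TotalSpace.ext rfl (heq_of_eq (hvel 0 h00))
      rw [h1, hβ0, hp]
      refine TotalSpace.ext ?_ ?_
      · show θ (r, θ (-r, γ t)) = γ t
        exact flow_apply_flow_neg hθ0 hθadd r (γ t)
      · show HEq (mfderiv (𝓡 4) (𝓡 4) (fun q ↦ θ (r, q)) (θ (-r, γ t)) k) v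
        have h2 : ∀ r' : ℝ, mfderiv (𝓡 4) (𝓡 4) (fun q ↦ θ (-r', q)) (θ (r', γ t))
            (mfderiv (𝓡 4) (𝓡 4) (fun q ↦ θ (r', q)) (γ t) v) = v := fun r' ↦
          PseudoRiemannianMetric.mfderiv_flow_neg_apply_mfderiv_flow hθ2 hθ0 hθadd r' (γ t) v
        have h3 := h2 (-r)
        rw [neg_neg] at h3
        rw [hk]
        exact heq_of_eq h3
    exact isMaximalGeodesicOn_add_mem_of_isGeodesicOn hγ ht hε hβ' hlift hu
  have hne : s.Nonempty := ⟨t₀, ht₀⟩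
  constructor
  · intro hB hbdd
    obtain ⟨t₁', ht₁'s, ht₁'⟩ := exists_lt_of_lt_csSup hne (show sSup s - ε / 2 < sSup s by linarith)
    obtain ⟨t₁, ht₁s, ht₀₁, ht₁⟩ : ∃ t₁ ∈ s, t₀ ≤ t₁ ∧ sSup s - ε / 2 < t₁ := by
      rcases le_total t₀ t₁' with h | h
      · exact ⟨t₁', ht₁'s, h, ht₁'⟩
      · exact ⟨t₀, ht₀, le_rfl, ht₁'.trans_le h⟩
    have hmem' : ε / 2 + t₁ ∈ s := key t₁ ht₁s (hB t₁ ht₁s ht₀₁) (ε / 2) ⟨by linarith, by linarith⟩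
    have := le_csSup hbdd hmem'
    linarith
  · intro hB hbdd
    obtain ⟨t₁', ht₁'s, ht₁'⟩ := exists_lt_of_csInf_lt hne (show sInf s < sInf s + ε / 2 by linarith)
    obtain ⟨t₁, ht₁s, ht₀₁, ht₁⟩ : ∃ t₁ ∈ s, t₁ ≤ t₀ ∧ t₁ < sInf s + ε / 2 := by
      rcases le_total t₁' t₀ with h | h
      · exact ⟨t₁', ht₁'s, h, ht₁'⟩
      · exact ⟨t₀, ht₀, le_rfl, h.trans_lt ht₁'⟩
    have hmem' : -(ε / 2) + t₁ ∈ s := key t₁ ht₁s (hB t₁ ht₁s ht₀₁) (-(ε / 2)) ⟨by linarith, by linarith⟩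
    have := csInf_le hbdd hmem'
    linarith

end Summit.FinalStateConjecture.FinalStateConjecture.Theorems.ErgoregionBombModT

end
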